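import Literature.Geometry.Riemannian.MeanConvexTube
import Literature.Geometry.Riemannian.MeanConvexSubharmonic
import Literature.Geometry.Riemannian.MeanConvexNormComp

/-!
# Defining functions of a mean-convex domain: comparison, positive multipliers, gluing, tubes

Topic `Geometry/Riemannian` (fact seat
`provefact-Literature.Geometry.Riemannian.LawsonMichelsohn1984_surrounding`).  Everything here
is **proved**; no definitions.

Small tools for the assembly of Lawson–Michelsohn's handle theorem (Thm. 3.1) in the
defining-function language of the fact `LawsonMichelsohn1984_surrounding`:

* `exists_fderiv_eq_smul_of_setOf_le_eq` — if `{G ≤ 0} = {f ≤ a}`, `f s = a` and `df(s) ≠ 0`,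
  then `dG(s) = μ df(s)` with `μ ≥ 0` (and `μ > 0` if `dG(s) ≠ 0`): two regular defining
  functions of the same domain have parallel gradients on the boundary;
* (positive multipliers preserve regularity and strict mean convexity:
  `MeanConvexSurroundingDefiningFunction.sum_iteratedFDeriv_two_mul_pos_iff`;)
* `contDiff_add_mul_of_tsupport_subset` — gluing: `G + χ (g - G)` is `C^n` when `g` is `C^n`
  on an open set containing the support of the cut-off `χ`;
* `sum_iteratedFDeriv_two_norm_comp_pos` — **the tube is mean convex**: if `u = ‖Y‖²` satisfies
  the subharmonicity criterion `sup_{‖w‖=1} D²u(w, w) < tr D²u` at `x` (`MeanConvexTube`,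
  `MeanConvexSubharmonic`) and `Y x ≠ 0`, then `∑ᵢ D²‖Y‖(x)(wᵢ, wᵢ) > 0` for every orthonormal
  `m`-frame `w` of `ker d‖Y‖(x)` (`dim E = m + 1`).

## References

* H. B. Lawson, Jr., M.-L. Michelsohn, *Embedding and surrounding with positive mean curvature*,
  Invent. Math. 77 (1984), §3. [LawsonMichelsohn1984]
-/

noncomputable section

open Set Function Filter Module
open scoped Topology RealInnerProductSpace ContDiff

namespace Literature.Geometry.Riemannian

/-! ### Two defining functions of one domain -/

section Parallel

variable {E : Type*} [NormedAddCommGroup E] [NormedSpace ℝ E]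

/-- Two linear functionals such that `φ w > 0 → 0 ≤ ψ w` are nonnegatively proportional.
[folklore] -/
theorem exists_eq_smul_of_pos_imp_nonneg (φ ψ : E →L[ℝ] ℝ) (hφ : φ ≠ 0)
    (h : ∀ w, 0 < φ w → 0 ≤ ψ w) : ∃ μ : ℝ, 0 ≤ μ ∧ ψ = μ • φ := by
  obtain ⟨w₀, hw₀⟩ : ∃ w₀, φ w₀ ≠ 0 := by
    by_contra hcon
    push Not at hcon
    exact hφ (ContinuousLinearMap.ext fun w => by simpa using hcon w)
  obtain ⟨w₁, hw₁⟩ : ∃ w₁ : E, w₁ = (φ w₀)⁻¹ • w₀ := ⟨_, rfl⟩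
  have hφw₁ : φ w₁ = 1 := by rw [hw₁, map_smul, smul_eq_mul, inv_mul_cancel₀ hw₀]
  obtain ⟨μ, hμ⟩ : ∃ μ : ℝ, μ = ψ w₁ := ⟨_, rfl⟩
  have hμ0 : 0 ≤ μ := by rw [hμ]; exact h w₁ (by rw [hφw₁]; exact one_pos)
  -- `ψ` vanishes on `ker φ`
  have hker : ∀ u, φ u = 0 → ψ u = 0 := by
    intro u hu
    have hle : ∀ t : ℝ, 0 ≤ μ + t * ψ u := fun t => by
      have := h (w₁ + t • u) (by rw [map_add, hφw₁, map_smul, hu, smul_zero, add_zero]; exact one_pos)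
      rw [map_add, map_smul, smul_eq_mul, ← hμ] at this
      exact this
    by_contra hne
    have h1 := hle (-(μ + 1) / ψ u)
    rw [div_mul_cancel₀ _ hne] at h1
    linarith
  refine ⟨μ, hμ0, ContinuousLinearMap.ext fun w => ?_⟩
  have hdec : φ (w - φ w • w₁) = 0 := by rw [map_sub, map_smul, hφw₁, smul_eq_mul, mul_one, sub_self]
  have h1 := hker _ hdec
  rw [map_sub, map_smul, smul_eq_mul, sub_eq_zero] at h1
  show ψ w = μ * φ w
  rw [h1, hμ]
  ring

/-- **Parallel gradients.**  If `{G ≤ 0} = {f ≤ a}`, `f s = a`, `f` and `G` are differentiable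
at `s` and `df(s) ≠ 0`, then `G s = 0` and `dG(s) = μ df(s)` for some `μ ≥ 0`. [folklore] -/
theorem exists_fderiv_eq_smul_of_setOf_le_eq {f G : E → ℝ} {a : ℝ} {s : E}
    (hset : {x | G x ≤ 0} = {x | f x ≤ a}) (hs : f s = a) (hf : DifferentiableAt ℝ f s)
    (hG : DifferentiableAt ℝ G s) (hdf : fderiv ℝ f s ≠ 0) :
    G s = 0 ∧ ∃ μ : ℝ, 0 ≤ μ ∧ fderiv ℝ G s = μ • fderiv ℝ f s := by
  have hiff : ∀ x, G x ≤ 0 ↔ f x ≤ a := fun x => Set.ext_iff.1 hset x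
  -- along a direction `w` with `df w > 0`, `f > a` hence `G > 0` for small `t > 0`
  have hpos_dir : ∀ w, 0 < fderiv ℝ f s w → ∀ᶠ t in 𝓝[>] (0 : ℝ), 0 < G (s + t • w) := by
    intro w hw
    have hline : HasDerivAt (fun t : ℝ => f (s + t • w)) (fderiv ℝ f s w) 0 := by
      have h1 : HasFDerivAt f (fderiv ℝ f s) (s + (0 : ℝ) • w) := by
        rw [zero_smul, add_zero]; exact hf.hasFDerivAt
      have h2 : HasDerivAt (fun t : ℝ => s + t • w) w 0 := by
        simpa using ((hasDerivAt_id (0 : ℝ)).smul_const w).const_add s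
      exact h1.comp_hasDerivAt 0 h2
    have hev := hline.tendsto_slope_zero_right.eventually (Ioi_mem_nhds hw)
    filter_upwards [hev, self_mem_nhdsWithin] with t ht ht0
    rw [zero_add, zero_smul, add_zero, hs, smul_eq_mul] at ht
    have hft : a < f (s + t • w) := by
      have := (mul_pos_iff_of_pos_left (inv_pos.2 (mem_Ioi.1 ht0))).1 ht
      linarith
    by_contra hle
    push Not at hle
    exact absurd ((hiff _).1 hle) (not_le.2 hft)
  -- `G s = 0`
  have hGs : G s = 0 := by
    have hle : G s ≤ 0 := (hiff s).2 hs.le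
    obtain ⟨w, hw⟩ : ∃ w, 0 < fderiv ℝ f s w := by
      by_contra hcon
      push Not at hcon
      apply hdf
      ext w
      have h1 := hcon w
      have h2 := hcon (-w)
      rw [map_neg] at h2
      exact le_antisymm h1 (neg_nonpos.1 h2)
    have hcont : Tendsto (fun t : ℝ => G (s + t • w)) (𝓝 0) (𝓝 (G s)) := by
      have h1 : Tendsto (fun t : ℝ => s + t • w) (𝓝 0) (𝓝 s) := by
        have hc : Continuous (fun t : ℝ => s + t • w) := by fun_prop
        simpa using hc.tendsto 0
      exact hG.continuousAt.tendsto.comp h1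
    have hge : 0 ≤ G s :=
      ge_of_tendsto (hcont.mono_left nhdsWithin_le_nhds) ((hpos_dir w hw).mono fun t ht => ht.le)
    linarith
  refine ⟨hGs, exists_eq_smul_of_pos_imp_nonneg _ _ hdf fun w hw => ?_⟩
  -- `dG w ≥ 0` when `df w > 0`
  have hline : HasDerivAt (fun t : ℝ => G (s + t • w)) (fderiv ℝ G s w) 0 := by
    have h1 : HasFDerivAt G (fderiv ℝ G s) (s + (0 : ℝ) • w) := by
      rw [zero_smul, add_zero]; exact hG.hasFDerivAt
    have h2 : HasDerivAt (fun t : ℝ => s + t • w) w 0 := by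
      simpa using ((hasDerivAt_id (0 : ℝ)).smul_const w).const_add s
    exact h1.comp_hasDerivAt 0 h2
  have hlim := hline.tendsto_slope_zero_right
  refine ge_of_tendsto hlim ?_
  filter_upwards [hpos_dir w hw, self_mem_nhdsWithin] with t ht ht0
  rw [zero_add, zero_smul, add_zero, hGs, sub_zero]
  exact smul_nonneg (inv_pos.2 (mem_Ioi.1 ht0)).le ht.le

end Parallel

/-! ### Gluing -/

section Gluing

variable {E : Type*} [NormedAddCommGroup E] [NormedSpace ℝ E] {n : WithTop ℕ∞}

/-- **Gluing by a cut-off.**  If `g` is `C^n` on the open set `O`, `G` and `χ` are `C^n`, and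
the (topological) support of `χ` is contained in `O`, then `G + χ (g - G)` is `C^n` (it is `g` where
`χ = 1` and `G` off the support of `χ`). [folklore] -/
theorem contDiff_add_mul_of_tsupport_subset {g G χ : E → ℝ} {O : Set E} (hO : IsOpen O)
    (hg : ContDiffOn ℝ n g O) (hG : ContDiff ℝ n G) (hχ : ContDiff ℝ n χ) (hsupp : tsupport χ ⊆ O) :
    ContDiff ℝ n fun z => G z + χ z * (g z - G z) := by
  refine contDiff_iff_contDiffAt.2 fun z => ?_
  by_cases hz : z ∈ O
  · exact hG.contDiffAt.add (hχ.contDiffAt.mul ((hg.contDiffAt (hO.mem_nhds hz)).sub hG.contDiffAt))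
  · -- off `O`, hence off the support: locally `G`
    have hz' : z ∉ tsupport χ := fun h => hz (hsupp h)
    have hev : (fun z => G z + χ z * (g z - G z)) =ᶠ[𝓝 z] G := by
      have : ∀ᶠ y in 𝓝 z, χ y = 0 := by
        have ho : IsOpen (tsupport χ)ᶜ := (isClosed_tsupport χ).isOpen_compl
        filter_upwards [ho.mem_nhds hz'] with y hy
        exact image_eq_zero_of_notMem_tsupport hy
      filter_upwards [this] with y hy
      rw [hy, zero_mul, add_zero]
    exact hG.contDiffAt.congr_of_eventuallyEq hev

end Gluing

/-! ### The tube around the core is mean convex -/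

section TubeMC

variable {E F : Type*} [NormedAddCommGroup E] [InnerProductSpace ℝ E] [FiniteDimensional ℝ E]
  [NormedAddCommGroup F] [InnerProductSpace ℝ F] {m : ℕ}

omit [FiniteDimensional ℝ E] in
/-- The Hessian of `‖Y‖²`: `D²(‖Y‖²)(x)(v, w) = 2 ⟨DY v, DY w⟩ + 2 ⟨Y x, D²Y(x)(v, w)⟩`.
[folklore] -/
theorem iteratedFDeriv_two_norm_sq_comp {Y : E → F} {x : E} (hY : ContDiffAt ℝ 2 Y x) (v w : E) :
    iteratedFDeriv ℝ 2 (fun z => ‖Y z‖ ^ 2) x ![v, w] =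
      2 * ⟪fderiv ℝ Y x v, fderiv ℝ Y x w⟫ + 2 * ⟪Y x, fderiv ℝ (fderiv ℝ Y) x v w⟫ := by
  have hΦ : ContDiffAt ℝ 2 (fun y : F => ‖y‖ ^ 2) (Y x) := (contDiff_norm_sq ℝ).contDiffAt
  rw [iteratedFDeriv_two_vecCons]
  have h := fderiv_fderiv_comp_apply_two (Φ := fun y : F => ‖y‖ ^ 2) hY hΦ v w
  have hcomp : ((fun y : F => ‖y‖ ^ 2) ∘ Y) = fun z => ‖Y z‖ ^ 2 := rfl
  rw [hcomp] at h
  have e : fderiv ℝ (fderiv ℝ fun z => ‖Y z‖ ^ 2) x v w =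
      fderiv ℝ (fun z => fderiv ℝ (fun z => ‖Y z‖ ^ 2) z) x v w := rfl
  have hd1 : fderiv ℝ (fun y : F => ‖y‖ ^ 2) = fun y => (2 : ℝ) • innerSL ℝ y := by
    ext1 y; rw [fderiv_norm_sq_apply, ← Nat.cast_smul_eq_nsmul ℝ, Nat.cast_ofNat]
  have hd2 : fderiv ℝ (fderiv ℝ (fun y : F => ‖y‖ ^ 2)) (Y x) =
      (2 : ℝ) • (innerSL ℝ : F →L[ℝ] F →L[ℝ] ℝ) := by
    rw [hd1]
    exact ((innerSL ℝ : F →L[ℝ] F →L[ℝ] ℝ).hasFDerivAt.const_smul (2 : ℝ)).fderiv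
  rw [e, h, hd2, hd1]
  show (2 : ℝ) • (innerSL ℝ (fderiv ℝ Y x v) (fderiv ℝ Y x w)) +
      (2 : ℝ) • (innerSL ℝ (Y x) (fderiv ℝ (fderiv ℝ Y) x v w)) = _
  simp only [innerSL_apply_apply, smul_eq_mul]

/-- **The tube is mean convex.**  Let `dim E = m + 1`, `Y : E → F` be `C²` at `x` with
`Y x ≠ 0`, and suppose `u = ‖Y‖²` satisfies the subharmonicity criterion at `x`:
`D²u(x)(w, w) ≤ Λ` for unit `w` and `Λ < ∑ⱼ D²u(x)(bⱼ, bⱼ)`.  Then `∑ᵢ D²‖Y‖(x)(wᵢ, wᵢ) > 0` for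
every orthonormal `m`-frame `w` with `d‖Y‖(x)(wᵢ) = 0` — the level tube `{‖Y‖ = ‖Y x‖}` is
strictly mean convex at `x`. [cite: LawsonMichelsohn1984, §3] -/
theorem sum_iteratedFDeriv_two_norm_comp_pos (hE : finrank ℝ E = m + 1) {Y : E → F} {x : E}
    (hY : ContDiffAt ℝ 2 Y x) (hx : Y x ≠ 0) {ι : Type*} [Fintype ι] (b : OrthonormalBasis ι ℝ E)
    {Λ : ℝ} (hΛ : ∀ w : E, ‖w‖ = 1 → iteratedFDeriv ℝ 2 (fun z => ‖Y z‖ ^ 2) x ![w, w] ≤ Λ)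
    (hlt : Λ < ∑ j, iteratedFDeriv ℝ 2 (fun z => ‖Y z‖ ^ 2) x ![b j, b j])
    (w : Fin m → E) (hw : Orthonormal ℝ w) (hw0 : ∀ i, fderiv ℝ (fun z => ‖Y z‖) x (w i) = 0) :
    0 < ∑ i, iteratedFDeriv ℝ 2 (fun z => ‖Y z‖) x ![w i, w i] := by
  have hpos := sum_iteratedFDeriv_two_pos_of_trace hE b hΛ hlt w hw
  have hr : 0 < ‖Y x‖ := norm_pos_iff.2 hx
  have hYd : DifferentiableAt ℝ Y x := hY.differentiableAt (by simp)
  -- the frame condition: `⟨ŷ, DY wᵢ⟩ = 0`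
  have hw0' : ∀ i, ⟪‖Y x‖⁻¹ • Y x, fderiv ℝ Y x (w i)⟫ = 0 := fun i => by
    rw [← fderiv_norm_comp_apply hYd hx]; exact hw0 i
  -- termwise: `D²‖Y‖(wᵢ, wᵢ) = D²u(wᵢ, wᵢ) / (2 ‖Y x‖)`
  have hterm : ∀ i, iteratedFDeriv ℝ 2 (fun z => ‖Y z‖) x ![w i, w i] =
      iteratedFDeriv ℝ 2 (fun z => ‖Y z‖ ^ 2) x ![w i, w i] / (2 * ‖Y x‖) := by
    intro i
    rw [iteratedFDeriv_two_vecCons, iteratedFDeriv_two_norm_sq_comp hY]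
    have e : fderiv ℝ (fderiv ℝ fun z => ‖Y z‖) x (w i) (w i) =
        fderiv ℝ (fun z => fderiv ℝ (fun z => ‖Y z‖) z) x (w i) (w i) := rfl
    rw [e, fderiv_fderiv_norm_comp_apply hY hx, hw0' i, mul_zero, sub_zero, real_inner_self_eq_norm_sq]
    rw [real_inner_smul_left]
    field_simp
  rw [Finset.sum_congr rfl fun i _ => hterm i, ← Finset.sum_div]
  exact div_pos hpos (by positivity)

end TubeMC

end Literature.Geometry.Riemannian

end
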